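import Mathlib
import HarnessLib
import Summits.ResolutionOfSingularities.ResolutionOfSingularities.Theorems.HomologicalConductorPersistenceKC3XbSpan

/-!
# Crux `Persistence` (stmt-ResolutionOfSingularities-16484), chain W4.4b — K-C3 K4e (3/4):
# `N|_{P₀} = span_{P₀} {w p}` for the relation module of `X_b`

Route `ResolutionOfSingularities/HomologicalConductor`.  OURS (cell res-hironaka, crux chain W4.4b, K-C3 K4e;
certificate `cert.py`; seat res-D-pv-058); nothing here is a statement of the manuscript under review
(Hironaka 2017); AI-written, weaker than expert review.

From the 72 identities of parts 1–2 (`…KC3XbGens`, `…KC3XbSpan`): every `gen l j = βⱼ • ∂_l` lies in the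
`P₀`-span of the eighteen pivot vectors (`mem_l_j`), hence **`restrictScalars_range_eq_span`**: the relation
module `N = ∂ W₀¹²` of `X_b = W₀⁸ ⧸ N`, restricted to `P₀ = kc3P k`, is `span_{P₀} {w₀, …, w₁₇}` (`⊆`:
`∂ y = Σ y_l ∂_l`, `y_l = Σⱼ (repr y_l)ⱼ βⱼ` on res-D-pv-037's `kc3Basis`; `⊇`: `w_mem`). Part 4 (`…KC3XbLattice`)
reads the pivot coordinates and concludes `Module.Projective ↥(kc3P k) (kc3Xb k)`. [OURS; a finite certificate.]
-/

noncomputable section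

-- single-problem summit: the doubled namespace component `ResolutionOfSingularities` is forced
set_option linter.dupNamespace false

open MvPolynomial
open Summit.ResolutionOfSingularities.ResolutionOfSingularities.Theorems.HomologicalConductor.KC3Witness
open Summit.ResolutionOfSingularities.ResolutionOfSingularities.Theorems.HomologicalConductor.KC3FrobeniusOrder
open Summit.ResolutionOfSingularities.ResolutionOfSingularities.Theorems.HomologicalConductor.KC3WitnessBaseChange

universe u

namespace Summit.ResolutionOfSingularities.ResolutionOfSingularities.Theorems.HomologicalConductor.KC3XbLattice

variable (k : Type u) [Field k]

/-- The pivot vectors lie in their span. [folklore] -/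
theorem hw (p : Fin 18) : w k p ∈ Submodule.span ↥(kc3P k) (Set.range (w k)) :=
  Submodule.subset_span ⟨p, rfl⟩

variable {k}

/-! ## The 72 memberships `gen l j ∈ span_{P₀} {w p}` -/

/-- `gen 0 0 ∈ span_{P₀} {w p}`. [OURS · certificate] -/
theorem mem_0_0 : gen k 0 0 ∈ Submodule.span ↥(kc3P k) (Set.range (w k)) :=
  gen_0_0 (k := k) ▸ hw k 0

/-- `gen 0 1 ∈ span_{P₀} {w p}`. [OURS · certificate] -/
theorem mem_0_1 : gen k 0 1 ∈ Submodule.span ↥(kc3P k) (Set.range (w k)) :=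
  gen_0_1 (k := k) ▸ hw k 1

/-- `gen 0 2 ∈ span_{P₀} {w p}`. [OURS · certificate] -/
theorem mem_0_2 : gen k 0 2 ∈ Submodule.span ↥(kc3P k) (Set.range (w k)) :=
  gen_0_2 (k := k) ▸ Submodule.sub_mem _ (Submodule.smul_mem _ _ (hw k 5)) (Submodule.smul_mem _ _ (hw k 7))

/-- `gen 0 3 ∈ span_{P₀} {w p}`. [OURS · certificate] -/
theorem mem_0_3 : gen k 0 3 ∈ Submodule.span ↥(kc3P k) (Set.range (w k)) :=
  gen_0_3 (k := k) ▸ Submodule.smul_mem _ _ (hw k 4)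

/-- `gen 0 4 ∈ span_{P₀} {w p}`. [OURS · certificate] -/
theorem mem_0_4 : gen k 0 4 ∈ Submodule.span ↥(kc3P k) (Set.range (w k)) :=
  gen_0_4 (k := k) ▸ Submodule.smul_mem _ _ (hw k 2)

/-- `gen 0 5 ∈ span_{P₀} {w p}`. [OURS · certificate] -/
theorem mem_0_5 : gen k 0 5 ∈ Submodule.span ↥(kc3P k) (Set.range (w k)) :=
  gen_0_5 (k := k) ▸ Submodule.smul_mem _ _ (hw k 3)

/-- `gen 1 0 ∈ span_{P₀} {w p}`. [OURS · certificate] -/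
theorem mem_1_0 : gen k 1 0 ∈ Submodule.span ↥(kc3P k) (Set.range (w k)) :=
  gen_1_0 (k := k) ▸ hw k 2

/-- `gen 1 1 ∈ span_{P₀} {w p}`. [OURS · certificate] -/
theorem mem_1_1 : gen k 1 1 ∈ Submodule.span ↥(kc3P k) (Set.range (w k)) :=
  gen_1_1 (k := k) ▸ Submodule.neg_mem _ (hw k 3)

/-- `gen 1 2 ∈ span_{P₀} {w p}`. [OURS · certificate] -/
theorem mem_1_2 : gen k 1 2 ∈ Submodule.span ↥(kc3P k) (Set.range (w k)) :=
  gen_1_2 (k := k) ▸ Submodule.smul_mem _ _ (hw k 4)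

/-- `gen 1 3 ∈ span_{P₀} {w p}`. [OURS · certificate] -/
theorem mem_1_3 : gen k 1 3 ∈ Submodule.span ↥(kc3P k) (Set.range (w k)) :=
  gen_1_3 (k := k) ▸ hw k 1

/-- `gen 1 4 ∈ span_{P₀} {w p}`. [OURS · certificate] -/
theorem mem_1_4 : gen k 1 4 ∈ Submodule.span ↥(kc3P k) (Set.range (w k)) :=
  gen_1_4 (k := k) ▸ Submodule.sub_mem _ (Submodule.smul_mem _ _ (hw k 5)) (Submodule.smul_mem _ _ (hw k 7))

/-- `gen 1 5 ∈ span_{P₀} {w p}`. [OURS · certificate] -/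
theorem mem_1_5 : gen k 1 5 ∈ Submodule.span ↥(kc3P k) (Set.range (w k)) :=
  gen_1_5 (k := k) ▸ Submodule.smul_mem _ _ (hw k 0)

/-- `gen 2 0 ∈ span_{P₀} {w p}`. [OURS · certificate] -/
theorem mem_2_0 : gen k 2 0 ∈ Submodule.span ↥(kc3P k) (Set.range (w k)) :=
  gen_2_0 (k := k) ▸ hw k 4

/-- `gen 2 1 ∈ span_{P₀} {w p}`. [OURS · certificate] -/
theorem mem_2_1 : gen k 2 1 ∈ Submodule.span ↥(kc3P k) (Set.range (w k)) :=
  gen_2_1 (k := k) ▸ Submodule.smul_mem _ _ (hw k 2)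

/-- `gen 2 2 ∈ span_{P₀} {w p}`. [OURS · certificate] -/
theorem mem_2_2 : gen k 2 2 ∈ Submodule.span ↥(kc3P k) (Set.range (w k)) :=
  gen_2_2 (k := k) ▸ Submodule.neg_mem _ (hw k 3)

/-- `gen 2 3 ∈ span_{P₀} {w p}`. [OURS · certificate] -/
theorem mem_2_3 : gen k 2 3 ∈ Submodule.span ↥(kc3P k) (Set.range (w k)) :=
  gen_2_3 (k := k) ▸ Submodule.smul_mem _ _ (hw k 0)

/-- `gen 2 4 ∈ span_{P₀} {w p}`. [OURS · certificate] -/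
theorem mem_2_4 : gen k 2 4 ∈ Submodule.span ↥(kc3P k) (Set.range (w k)) :=
  gen_2_4 (k := k) ▸ hw k 1

/-- `gen 2 5 ∈ span_{P₀} {w p}`. [OURS · certificate] -/
theorem mem_2_5 : gen k 2 5 ∈ Submodule.span ↥(kc3P k) (Set.range (w k)) :=
  gen_2_5 (k := k) ▸ Submodule.sub_mem _ (Submodule.smul_mem _ _ (hw k 5)) (Submodule.smul_mem _ _ (hw k 7))

/-- `gen 3 0 ∈ span_{P₀} {w p}`. [OURS · certificate] -/
theorem mem_3_0 : gen k 3 0 ∈ Submodule.span ↥(kc3P k) (Set.range (w k)) :=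
  gen_3_0 (k := k) ▸ hw k 5

/-- `gen 3 1 ∈ span_{P₀} {w p}`. [OURS · certificate] -/
theorem mem_3_1 : gen k 3 1 ∈ Submodule.span ↥(kc3P k) (Set.range (w k)) :=
  gen_3_1 (k := k) ▸ Submodule.sub_mem _ (Submodule.smul_mem _ _ (hw k 0)) (Submodule.smul_mem _ _ (hw k 11))

/-- `gen 3 2 ∈ span_{P₀} {w p}`. [OURS · certificate] -/
theorem mem_3_2 : gen k 3 2 ∈ Submodule.span ↥(kc3P k) (Set.range (w k)) :=
  gen_3_2 (k := k) ▸ Submodule.sub_mem _ (hw k 1) (Submodule.smul_mem _ _ (hw k 10))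

/-- `gen 3 3 ∈ span_{P₀} {w p}`. [OURS · certificate] -/
theorem mem_3_3 : gen k 3 3 ∈ Submodule.span ↥(kc3P k) (Set.range (w k)) :=
  gen_3_3 (k := k) ▸ Submodule.smul_mem _ _ (hw k 6)

/-- `gen 3 4 ∈ span_{P₀} {w p}`. [OURS · certificate] -/
theorem mem_3_4 : gen k 3 4 ∈ Submodule.span ↥(kc3P k) (Set.range (w k)) :=
  gen_3_4 (k := k) ▸ Submodule.sub_mem _ (Submodule.smul_mem _ _ (hw k 4)) (Submodule.smul_mem _ _ (hw k 8))

/-- `gen 3 5 ∈ span_{P₀} {w p}`. [OURS · certificate] -/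
theorem mem_3_5 : gen k 3 5 ∈ Submodule.span ↥(kc3P k) (Set.range (w k)) :=
  gen_3_5 (k := k) ▸ Submodule.sub_mem _ (Submodule.smul_mem _ _ (hw k 2)) (Submodule.smul_mem _ _ (hw k 9))

/-- `gen 4 0 ∈ span_{P₀} {w p}`. [OURS · certificate] -/
theorem mem_4_0 : gen k 4 0 ∈ Submodule.span ↥(kc3P k) (Set.range (w k)) :=
  gen_4_0 (k := k) ▸ Submodule.sub_mem _ (hw k 4) (hw k 8)

/-- `gen 4 1 ∈ span_{P₀} {w p}`. [OURS · certificate] -/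
theorem mem_4_1 : gen k 4 1 ∈ Submodule.span ↥(kc3P k) (Set.range (w k)) :=
  gen_4_1 (k := k) ▸ Submodule.sub_mem _ (Submodule.smul_mem _ _ (hw k 2)) (hw k 9)

/-- `gen 4 2 ∈ span_{P₀} {w p}`. [OURS · certificate] -/
theorem mem_4_2 : gen k 4 2 ∈ Submodule.span ↥(kc3P k) (Set.range (w k)) :=
  gen_4_2 (k := k) ▸ Submodule.smul_mem _ _ (hw k 6)

/-- `gen 4 3 ∈ span_{P₀} {w p}`. [OURS · certificate] -/
theorem mem_4_3 : gen k 4 3 ∈ Submodule.span ↥(kc3P k) (Set.range (w k)) :=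
  gen_4_3 (k := k) ▸ Submodule.sub_mem _ (Submodule.smul_mem _ _ (hw k 0)) (Submodule.smul_mem _ _ (hw k 11))

/-- `gen 4 4 ∈ span_{P₀} {w p}`. [OURS · certificate] -/
theorem mem_4_4 : gen k 4 4 ∈ Submodule.span ↥(kc3P k) (Set.range (w k)) :=
  gen_4_4 (k := k) ▸ Submodule.sub_mem _ (hw k 1) (Submodule.smul_mem _ _ (hw k 10))

/-- `gen 4 5 ∈ span_{P₀} {w p}`. [OURS · certificate] -/
theorem mem_4_5 : gen k 4 5 ∈ Submodule.span ↥(kc3P k) (Set.range (w k)) :=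
  gen_4_5 (k := k) ▸ Submodule.smul_mem _ _ (hw k 5)

/-- `gen 5 0 ∈ span_{P₀} {w p}`. [OURS · certificate] -/
theorem mem_5_0 : gen k 5 0 ∈ Submodule.span ↥(kc3P k) (Set.range (w k)) :=
  gen_5_0 (k := k) ▸ Submodule.neg_mem _ (hw k 6)

/-- `gen 5 1 ∈ span_{P₀} {w p}`. [OURS · certificate] -/
theorem mem_5_1 : gen k 5 1 ∈ Submodule.span ↥(kc3P k) (Set.range (w k)) :=
  gen_5_1 (k := k) ▸ Submodule.sub_mem _ (Submodule.smul_mem _ _ (hw k 4)) (Submodule.smul_mem _ _ (hw k 8))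

/-- `gen 5 2 ∈ span_{P₀} {w p}`. [OURS · certificate] -/
theorem mem_5_2 : gen k 5 2 ∈ Submodule.span ↥(kc3P k) (Set.range (w k)) :=
  gen_5_2 (k := k) ▸ Submodule.sub_mem _ (Submodule.smul_mem _ _ (hw k 2)) (hw k 9)

/-- `gen 5 3 ∈ span_{P₀} {w p}`. [OURS · certificate] -/
theorem mem_5_3 : gen k 5 3 ∈ Submodule.span ↥(kc3P k) (Set.range (w k)) :=
  gen_5_3 (k := k) ▸ Submodule.smul_mem _ _ (hw k 5)

/-- `gen 5 4 ∈ span_{P₀} {w p}`. [OURS · certificate] -/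
theorem mem_5_4 : gen k 5 4 ∈ Submodule.span ↥(kc3P k) (Set.range (w k)) :=
  gen_5_4 (k := k) ▸ Submodule.sub_mem _ (Submodule.smul_mem _ _ (hw k 0)) (Submodule.smul_mem _ _ (hw k 11))

/-- `gen 5 5 ∈ span_{P₀} {w p}`. [OURS · certificate] -/
theorem mem_5_5 : gen k 5 5 ∈ Submodule.span ↥(kc3P k) (Set.range (w k)) :=
  gen_5_5 (k := k) ▸ Submodule.sub_mem _ (Submodule.smul_mem _ _ (hw k 1)) (Submodule.smul_mem _ _ (hw k 10))

/-- `gen 6 0 ∈ span_{P₀} {w p}`. [OURS · certificate] -/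
theorem mem_6_0 : gen k 6 0 ∈ Submodule.span ↥(kc3P k) (Set.range (w k)) :=
  gen_6_0 (k := k) ▸ hw k 7

/-- `gen 6 1 ∈ span_{P₀} {w p}`. [OURS · certificate] -/
theorem mem_6_1 : gen k 6 1 ∈ Submodule.span ↥(kc3P k) (Set.range (w k)) :=
  gen_6_1 (k := k) ▸ Submodule.smul_mem _ _ (hw k 11)

/-- `gen 6 2 ∈ span_{P₀} {w p}`. [OURS · certificate] -/
theorem mem_6_2 : gen k 6 2 ∈ Submodule.span ↥(kc3P k) (Set.range (w k)) :=
  gen_6_2 (k := k) ▸ Submodule.smul_mem _ _ (hw k 10)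

/-- `gen 6 3 ∈ span_{P₀} {w p}`. [OURS · certificate] -/
theorem mem_6_3 : gen k 6 3 ∈ Submodule.span ↥(kc3P k) (Set.range (w k)) :=
  gen_6_3 (k := k) ▸ Submodule.sub_mem _ (hw k 3) (Submodule.smul_mem _ _ (hw k 6))

/-- `gen 6 4 ∈ span_{P₀} {w p}`. [OURS · certificate] -/
theorem mem_6_4 : gen k 6 4 ∈ Submodule.span ↥(kc3P k) (Set.range (w k)) :=
  gen_6_4 (k := k) ▸ Submodule.smul_mem _ _ (hw k 8)

/-- `gen 6 5 ∈ span_{P₀} {w p}`. [OURS · certificate] -/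
theorem mem_6_5 : gen k 6 5 ∈ Submodule.span ↥(kc3P k) (Set.range (w k)) :=
  gen_6_5 (k := k) ▸ Submodule.smul_mem _ _ (hw k 9)

/-- `gen 7 0 ∈ span_{P₀} {w p}`. [OURS · certificate] -/
theorem mem_7_0 : gen k 7 0 ∈ Submodule.span ↥(kc3P k) (Set.range (w k)) :=
  gen_7_0 (k := k) ▸ Submodule.neg_mem _ (hw k 8)

/-- `gen 7 1 ∈ span_{P₀} {w p}`. [OURS · certificate] -/
theorem mem_7_1 : gen k 7 1 ∈ Submodule.span ↥(kc3P k) (Set.range (w k)) :=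
  gen_7_1 (k := k) ▸ Submodule.neg_mem _ (hw k 9)

/-- `gen 7 2 ∈ span_{P₀} {w p}`. [OURS · certificate] -/
theorem mem_7_2 : gen k 7 2 ∈ Submodule.span ↥(kc3P k) (Set.range (w k)) :=
  gen_7_2 (k := k) ▸ Submodule.sub_mem _ (hw k 3) (Submodule.smul_mem _ _ (hw k 6))

/-- `gen 7 3 ∈ span_{P₀} {w p}`. [OURS · certificate] -/
theorem mem_7_3 : gen k 7 3 ∈ Submodule.span ↥(kc3P k) (Set.range (w k)) :=
  gen_7_3 (k := k) ▸ Submodule.smul_mem _ _ (hw k 11)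

/-- `gen 7 4 ∈ span_{P₀} {w p}`. [OURS · certificate] -/
theorem mem_7_4 : gen k 7 4 ∈ Submodule.span ↥(kc3P k) (Set.range (w k)) :=
  gen_7_4 (k := k) ▸ Submodule.smul_mem _ _ (hw k 10)

/-- `gen 7 5 ∈ span_{P₀} {w p}`. [OURS · certificate] -/
theorem mem_7_5 : gen k 7 5 ∈ Submodule.span ↥(kc3P k) (Set.range (w k)) :=
  gen_7_5 (k := k) ▸ Submodule.smul_mem _ _ (hw k 7)

/-- `gen 8 0 ∈ span_{P₀} {w p}`. [OURS · certificate] -/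
theorem mem_8_0 : gen k 8 0 ∈ Submodule.span ↥(kc3P k) (Set.range (w k)) :=
  gen_8_0 (k := k) ▸ Submodule.neg_mem _ (hw k 10)

/-- `gen 8 1 ∈ span_{P₀} {w p}`. [OURS · certificate] -/
theorem mem_8_1 : gen k 8 1 ∈ Submodule.span ↥(kc3P k) (Set.range (w k)) :=
  gen_8_1 (k := k) ▸ Submodule.smul_mem _ _ (hw k 7)

/-- `gen 8 2 ∈ span_{P₀} {w p}`. [OURS · certificate] -/
theorem mem_8_2 : gen k 8 2 ∈ Submodule.span ↥(kc3P k) (Set.range (w k)) :=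
  gen_8_2 (k := k) ▸ Submodule.smul_mem _ _ (hw k 11)

/-- `gen 8 3 ∈ span_{P₀} {w p}`. [OURS · certificate] -/
theorem mem_8_3 : gen k 8 3 ∈ Submodule.span ↥(kc3P k) (Set.range (w k)) :=
  gen_8_3 (k := k) ▸ Submodule.neg_mem _ (hw k 9)

/-- `gen 8 4 ∈ span_{P₀} {w p}`. [OURS · certificate] -/
theorem mem_8_4 : gen k 8 4 ∈ Submodule.span ↥(kc3P k) (Set.range (w k)) :=
  gen_8_4 (k := k) ▸ Submodule.sub_mem _ (hw k 3) (Submodule.smul_mem _ _ (hw k 6))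

/-- `gen 8 5 ∈ span_{P₀} {w p}`. [OURS · certificate] -/
theorem mem_8_5 : gen k 8 5 ∈ Submodule.span ↥(kc3P k) (Set.range (w k)) :=
  gen_8_5 (k := k) ▸ Submodule.smul_mem _ _ (hw k 8)

/-- `gen 9 0 ∈ span_{P₀} {w p}`. [OURS · certificate] -/
theorem mem_9_0 : gen k 9 0 ∈ Submodule.span ↥(kc3P k) (Set.range (w k)) :=
  gen_9_0 (k := k) ▸ Submodule.neg_mem _ (hw k 11)

/-- `gen 9 1 ∈ span_{P₀} {w p}`. [OURS · certificate] -/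
theorem mem_9_1 : gen k 9 1 ∈ Submodule.span ↥(kc3P k) (Set.range (w k)) :=
  gen_9_1 (k := k) ▸ Submodule.smul_mem _ _ (hw k 10)

/-- `gen 9 2 ∈ span_{P₀} {w p}`. [OURS · certificate] -/
theorem mem_9_2 : gen k 9 2 ∈ Submodule.span ↥(kc3P k) (Set.range (w k)) :=
  gen_9_2 (k := k) ▸ Submodule.smul_mem _ _ (hw k 7)

/-- `gen 9 3 ∈ span_{P₀} {w p}`. [OURS · certificate] -/
theorem mem_9_3 : gen k 9 3 ∈ Submodule.span ↥(kc3P k) (Set.range (w k)) :=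
  gen_9_3 (k := k) ▸ Submodule.smul_mem _ _ (hw k 8)

/-- `gen 9 4 ∈ span_{P₀} {w p}`. [OURS · certificate] -/
theorem mem_9_4 : gen k 9 4 ∈ Submodule.span ↥(kc3P k) (Set.range (w k)) :=
  gen_9_4 (k := k) ▸ Submodule.neg_mem _ (hw k 9)

/-- `gen 9 5 ∈ span_{P₀} {w p}`. [OURS · certificate] -/
theorem mem_9_5 : gen k 9 5 ∈ Submodule.span ↥(kc3P k) (Set.range (w k)) :=
  gen_9_5 (k := k) ▸ Submodule.sub_mem _ (Submodule.smul_mem _ _ (hw k 3)) (Submodule.smul_mem _ _ (hw k 6))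

/-- `gen 10 0 ∈ span_{P₀} {w p}`. [OURS · certificate] -/
theorem mem_10_0 : gen k 10 0 ∈ Submodule.span ↥(kc3P k) (Set.range (w k)) :=
  gen_10_0 (k := k) ▸ hw k 12

/-- `gen 10 1 ∈ span_{P₀} {w p}`. [OURS · certificate] -/
theorem mem_10_1 : gen k 10 1 ∈ Submodule.span ↥(kc3P k) (Set.range (w k)) :=
  gen_10_1 (k := k) ▸ Submodule.add_mem _ (Submodule.smul_mem _ _ (hw k 4)) (Submodule.smul_mem _ _ (hw k 15))

/-- `gen 10 2 ∈ span_{P₀} {w p}`. [OURS · certificate] -/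
theorem mem_10_2 : gen k 10 2 ∈ Submodule.span ↥(kc3P k) (Set.range (w k)) :=
  gen_10_2 (k := k) ▸ Submodule.add_mem _ (Submodule.smul_mem _ _ (hw k 2)) (Submodule.smul_mem _ _ (hw k 16))

/-- `gen 10 3 ∈ span_{P₀} {w p}`. [OURS · certificate] -/
theorem mem_10_3 : gen k 10 3 ∈ Submodule.span ↥(kc3P k) (Set.range (w k)) :=
  gen_10_3 (k := k) ▸ Submodule.add_mem _ (Submodule.smul_mem _ _ (hw k 5)) (Submodule.smul_mem _ _ (hw k 17))

/-- `gen 10 4 ∈ span_{P₀} {w p}`. [OURS · certificate] -/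
theorem mem_10_4 : gen k 10 4 ∈ Submodule.span ↥(kc3P k) (Set.range (w k)) :=
  gen_10_4 (k := k) ▸ Submodule.add_mem _ (Submodule.smul_mem _ _ (hw k 0)) (Submodule.smul_mem _ _ (hw k 13))

/-- `gen 10 5 ∈ span_{P₀} {w p}`. [OURS · certificate] -/
theorem mem_10_5 : gen k 10 5 ∈ Submodule.span ↥(kc3P k) (Set.range (w k)) :=
  gen_10_5 (k := k) ▸ Submodule.add_mem _ (Submodule.smul_mem _ _ (hw k 1)) (Submodule.smul_mem _ _ (hw k 14))

/-- `gen 11 0 ∈ span_{P₀} {w p}`. [OURS · certificate] -/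
theorem mem_11_0 : gen k 11 0 ∈ Submodule.span ↥(kc3P k) (Set.range (w k)) :=
  gen_11_0 (k := k) ▸ hw k 13

/-- `gen 11 1 ∈ span_{P₀} {w p}`. [OURS · certificate] -/
theorem mem_11_1 : gen k 11 1 ∈ Submodule.span ↥(kc3P k) (Set.range (w k)) :=
  gen_11_1 (k := k) ▸ hw k 14

/-- `gen 11 2 ∈ span_{P₀} {w p}`. [OURS · certificate] -/
theorem mem_11_2 : gen k 11 2 ∈ Submodule.span ↥(kc3P k) (Set.range (w k)) :=
  gen_11_2 (k := k) ▸ Submodule.add_mem _ (Submodule.neg_mem _ (hw k 7)) (hw k 17)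

/-- `gen 11 3 ∈ span_{P₀} {w p}`. [OURS · certificate] -/
theorem mem_11_3 : gen k 11 3 ∈ Submodule.span ↥(kc3P k) (Set.range (w k)) :=
  gen_11_3 (k := k) ▸ hw k 15

/-- `gen 11 4 ∈ span_{P₀} {w p}`. [OURS · certificate] -/
theorem mem_11_4 : gen k 11 4 ∈ Submodule.span ↥(kc3P k) (Set.range (w k)) :=
  gen_11_4 (k := k) ▸ hw k 16

/-- `gen 11 5 ∈ span_{P₀} {w p}`. [OURS · certificate] -/
theorem mem_11_5 : gen k 11 5 ∈ Submodule.span ↥(kc3P k) (Set.range (w k)) :=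
  gen_11_5 (k := k) ▸ Submodule.add_mem _ (Submodule.neg_mem _ (hw k 3)) (Submodule.smul_mem _ _ (hw k 12))

/-- Every generator `gen l j` is a `P₀`-combination of the pivot vectors. [OURS · certificate] -/
theorem gen_mem_span (l : Fin 12) (j : Fin 6) :
    gen k l j ∈ Submodule.span ↥(kc3P k) (Set.range (w k)) := by
  fin_cases l <;> fin_cases j
  exacts [mem_0_0, mem_0_1, mem_0_2, mem_0_3, mem_0_4, mem_0_5, mem_1_0, mem_1_1, mem_1_2, mem_1_3, mem_1_4, mem_1_5,
    mem_2_0, mem_2_1, mem_2_2, mem_2_3, mem_2_4, mem_2_5, mem_3_0, mem_3_1, mem_3_2, mem_3_3, mem_3_4, mem_3_5,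
    mem_4_0, mem_4_1, mem_4_2, mem_4_3, mem_4_4, mem_4_5, mem_5_0, mem_5_1, mem_5_2, mem_5_3, mem_5_4, mem_5_5,
    mem_6_0, mem_6_1, mem_6_2, mem_6_3, mem_6_4, mem_6_5, mem_7_0, mem_7_1, mem_7_2, mem_7_3, mem_7_4, mem_7_5,
    mem_8_0, mem_8_1, mem_8_2, mem_8_3, mem_8_4, mem_8_5, mem_9_0, mem_9_1, mem_9_2, mem_9_3, mem_9_4, mem_9_5,
    mem_10_0, mem_10_1, mem_10_2, mem_10_3, mem_10_4, mem_10_5, mem_11_0, mem_11_1, mem_11_2, mem_11_3, mem_11_4, mem_11_5]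

/-! ## `N|_{P₀} = span_{P₀} {w p}` -/

/-- `∂ y = Σ_l y_l • ∂_l`. [folklore] -/
theorem mulVec_eq_sum_col (y : Fin 12 → ↥(kc3W k)) : (kc3DW k).mulVec y = ∑ l, y l • col k l := by
  funext g
  simp only [Matrix.mulVec, dotProduct, col, Finset.sum_apply, Pi.smul_apply, smul_eq_mul]
  exact Finset.sum_congr rfl fun l _ => mul_comm _ _

/-- **The relation module of `X_b`, restricted to `P₀`, is spanned by the 18 pivot vectors.**
(`⊆`: `∂ y = Σ y_l ∂_l`, `y_l = Σⱼ (repr y_l)ⱼ βⱼ`, and `gen_mem_span`; `⊇`: `w_mem`.) [OURS] -/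
theorem restrictScalars_range_eq_span :
    (LinearMap.range (kc3DW k).mulVecLin).restrictScalars ↥(kc3P k) =
      Submodule.span ↥(kc3P k) (Set.range (w k)) := by
  apply le_antisymm
  · intro x hx
    rw [Submodule.restrictScalars_mem, LinearMap.mem_range] at hx
    obtain ⟨y, rfl⟩ := hx
    rw [Matrix.mulVecLin_apply, mulVec_eq_sum_col]
    refine Submodule.sum_mem _ fun l _ => ?_
    rw [← (kc3Basis k).sum_repr (y l), Finset.sum_smul]
    refine Submodule.sum_mem _ fun j _ => ?_
    rw [smul_assoc, kc3Basis_apply]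
    exact Submodule.smul_mem _ _ (gen_mem_span l j)
  · rw [Submodule.span_le]
    rintro _ ⟨p, rfl⟩
    exact w_mem p

end Summit.ResolutionOfSingularities.ResolutionOfSingularities.Theorems.HomologicalConductor.KC3XbLattice

end
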